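import Literature.MathematicalPhysics.QuantumFieldTheory.Balaban1983to89.B15Prop1OntoFromRightInverseTower
import Literature.MathematicalPhysics.QuantumFieldTheory.Balaban1983to89.B15Prop1LinearisedDatumCoordinatesTowerB

/-!
# `Balaban1983to89.B15Prop1OntoFromRightInverseTower` — [Balaban1985Variational] = «[15]», Sect. C (45) p. 285 («L^jηQ_jHB = B»), (47)–(48), (82)–(83) p. 290; [Balaban1988Convergent] (2.10)–(2.11) p. 256: — **BOND-DATUM EDITION** (`…B15Prop1OntoFromRightInverseTowerB`): the print-datum ([Balaban1984PropagatorsII] (2.3)) twin of `B15Prop1OntoFromRightInverseTower` — class (γ) of dag-n12-c's census-by-declaration v2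
(bus [DAGN12C-G35], 2026-08-30): the parent reads its determining set `𝐁 : DetSet` only through `AgreeOn 𝐁 ∕ IsMinimizer … 𝐁 ∕ n07-w2's index `constrCard ∕ constrEnum 𝐁 k` ∕ `msChart``,
so the twin is a GENERATOR file (HOME `lean/g35/gen/gen_whole.py`): namespace `…B`, SAME declaration names, `DetSet ↦ BDetSet` (F0a), `AgreeOn ↦ AgreeOnB`, `IsMinimizer ↦ IsMinimizerB`,
`bondsOf (𝐁 j) ↦ 𝔅 j`, `constrCard ∕ constrEnum ∕ ConstrSet ∕ msChart ↦ …B` (lane `Node00/MultiScaleFibreChartB`), `IsCritOnFibre ∕ IsFibreChartNear ↦ …B`; proofs VERBATIM; the parent's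
datum-free declarations are re-elaborated under the same names in the `…B` namespace (harmless duplicates) or reused via `open`.  The (b) statements are the instances `𝔅 := bondsDet 𝐁` (`Iff.rfl`).

statement-level skeleton of published theorems with citation tags; proofs where landed; nothing here is a claim about
the Yang–Mills mass gap

Cell `pub-ymgap` (HUMAN RULINGS D-0062 ∕ D-0149), lane `pub-ymgap-dag-n12-c` g35 (R134 seat (a), N12 = [B15], s1, lane owner); `--kind proof --supports` K1⁹ `stmt-QuantumFields-27364`; count-neutral.
THEOREMS ONLY unless the parent has `def`s (then `--kind definition`).  HONESTY GUARD (director-ym №338 (5)): PURELY ADDITIVE — the parent stays landed and true on its own text; nothing in it is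
edited; no displayed premise of any consumer is deleted or weakened; every hypothesis of the parent stays a hypothesis.  Nothing of Bałaban's analysis asserted; count-neutral; N12 NOT discharged; K0⁷ ∕
K1⁹ NOT closed; one finite 𝕋⁴ programme at fixed ε — nothing continuum ∕ ℝ⁴ ∕ OS; the Yang–Mills mass gap (Clay) is NOT proved by any of this.

PARENT's DOCSTRING (for the mathematics and the citations; read `𝐁` as the bond datum `𝔅`):
# `Balaban1983to89.B15Prop1OntoFromRightInverseTower` — [Balaban1985Variational] = «[15]», Sect. C (45) p. 285 («L^jηQ_jHB = B»), (47)–(48), (82)–(83) p. 290; [Balaban1988Convergent] (2.10)–(2.11) p. 256: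
# THE LETTER `honto` FROM A REAL RIGHT INVERSE OF THE LINEARISED AVERAGING IN VELOCITY CURRENCY, UNDER THE PER-TOWER (0.4) GUARDS — the «TP» twin of `B15Prop1OntoFromRightInverse`
# (LOCATED-E1-HSB repair step (r3), link 4∕9)

Honest framing: statement-level skeleton of published theorems with citation tags; proofs where landed; nothing here is a claim about the
Yang–Mills mass gap.  Cell `pub-ymgap`, HUMAN RULING D-0062 (Track A), seat `pub-ymgap-dag-n12-c` g24 (lane owner N12 = [B15], strategy s1; lane memo `N12-UNIFORMITY-SPEC.md` §6,
plan g91 word pub-ymgap INBOX l.45435 «(r3) = ADDITIVE TP-twins»); count-neutral; N12 NOT discharged; finite 𝕋⁴ at fixed ε; nothing continuum ∕ OS ∕ mass-gap ∕ Clay.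

WHAT CHANGES AGAINST THE TWIN (dag-n12-w1 g2's `honto_of_rightInverse`, untouched).  The global guard `hsb : SmallBelow k U₀` is replaced by the ENUMERATED per-tower guards `hg` at the
constrained bonds of `𝔹` (+ `hk : k ≤ m + K`); the VELOCITY-currency right-inverse letter `hH` is UNCHANGED (it is intrinsic: the group-valued averages `Ū^j(exp(s p)·U₀)(c)` at the
constrained bonds and their `s`-derivatives — no `fderiv` of a total extension is read); the proof is the twin's verbatim over `…LinearisedDatumCoordinatesTower` ∕ `…DatumCoordinatesTower`.
`logCoordCLM_genE_sum` is the twin's.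

CONTENTS (theorems only; no `def`, no `instance`, no `sorry`).  ★★ `honto_of_rightInverse_of_guardOn`.
-/


noncomputable section

namespace Literature.MathematicalPhysics.QuantumFieldTheory.Balaban1983to89.B15Prop1OntoFromRightInverseTowerB
open B15Prop1DatumCoordinatesTowerB B15Prop1LinearisedDatumCoordinatesTowerB

open B15Prop1OntoFromRightInverseTower

open Set Filter
open scoped Topology ContDiff ComplexConjugate
open Literature.Analysis.Calculus.LagrangeHessianRealCoercive (surjective_of_real_surjective)
open Literature.MathematicalPhysics.QuantumFieldTheory.Balaban1983to89.Node00 (SU coeField coeField_apply SmallBelow ConstrSetB constrCardB constrEnumB star_coe_mul_coe_SU)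
open B15AveragingHolomorphic (iterMh)
open B15SU2ChartHolomorphic (genE expMulC logCoordC trace_genE_mul_genE)
open B15Prop1StateChartSU2 (exists_conjCLM_pi analyticAt_expMulC_right)
open B15Prop1DatumCoordinates (expMulC_zero_left)
open B15Prop1DatumCoordinatesTower (eventually_analyticAt_datumCoord_of_guardOn)
open B15Prop1LinearisedDatumCoordinates (exists_logCoordCLM)
open B15Prop1LinearisedDatumCoordinatesTower (fderiv_datumCoord_expMulC_apply_of_hasDerivAt_of_guardOn)
open B15Prop1OntoFromRightInverse (logCoordCLM_genE_sum)
open B15Prop1AnalyticExtClause (cplxVec)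
open B15Prop1ChartCalculusSU2 (E3)
open B15Prop1ChartSU2 (su2Chart)
open B16Sect1Backgrounds (expMul)
open ExpMeanLog (expMeanLogSU)
open BlockAveraging (blockAvg)
open T4CubeChartGnomonic (SU2)
open T4Continuum B15DeterminingSets B15DeterminingSetsB GaugeField
open scoped Matrix.Norms.L2Operator

variable {P : Params}

/-- ★★ **`honto` FROM A REAL RIGHT INVERSE OF THE LINEARISED AVERAGING (velocity currency).**  Base configuration `U₀` on the fibre of `W`, guarded below `k`; constraint coordinates
`Φ₀ X = κ (expMulC X ↑U₀)` (`κ` pointwise as in `B15Prop1DatumCoordinates`); a slice `S`.  Hypothesis `hH` ([15] (45)): for every family `τ : Fin n → ℝ³` there is a real bond field `p` with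
`cplxVec p ∈ S` such that for every constrained bond `(j,c)` the relative average `s ↦ ↑Ū^j(exp(s p)·U₀)(c)` has velocity `↑W_j(c) · Σ_a τ_{i,a} E_a` at `0`.  Conclusion: the derivative at `0`
of `Φ₀` restricted to `S` is surjective. [cite: Balaban1985Variational, Sect. C (45),(47)–(48) p.285, (82)–(83) p.290; Balaban1988Convergent, (2.10)–(2.11) p.256] -/
theorem honto_of_rightInverse_of_guardOn (𝔅 : BDetSet P) (k : ℕ) (hk : k ≤ P.m + P.K) (W : MSField P SU2)
    (κ : (PBond P 0 → Matrix (Fin 2) (Fin 2) ℂ) → Fin (constrCardB 𝔅 k) → EuclideanSpace ℂ (Fin 3))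
    (hκ : ∀ Q i, κ Q i = logCoordC (star ((W ((constrEnumB 𝔅 k).symm i).1 ((constrEnumB 𝔅 k).symm i).2.1 : SU2) : Matrix (Fin 2) (Fin 2) ℂ) *
      iterMh ((constrEnumB 𝔅 k).symm i).1 Q ((constrEnumB 𝔅 k).symm i).2.1))
    {U₀ : GaugeField P 0 SU2}
    (hg : ∀ i : Fin (constrCardB 𝔅 k), ∀ j', j' < (((constrEnumB 𝔅 k).symm i).1 : ℕ) → ∀ c' : PBond P (j' + 1),
      c' ∈ B10Eq42TorusConstraint.bondsIn (j' + 1) (B14.Eq22Determines.blockIter (((constrEnumB 𝔅 k).symm i).1 : ℕ) ⁻¹'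
        ({((constrEnumB 𝔅 k).symm i).2.1.src, ((constrEnumB 𝔅 k).symm i).2.1.tgt} : Set (Site P ((constrEnumB 𝔅 k).symm i).1))) →
        BlockAveraging.Small expMeanLogSU (Averaging.iter (fun j => blockAvg (P := P) (j := j) expMeanLogSU) j' U₀) c')
    (hU : AgreeOnB 𝔅 (avgFamily (fun j => blockAvg (P := P) (j := j) expMeanLogSU) U₀) W)
    (S : Submodule ℂ (VecField P 0 (EuclideanSpace ℂ (Fin 3))))
    (Φ₀ : S → Fin (constrCardB 𝔅 k) → EuclideanSpace ℂ (Fin 3)) (hΦ₀ : ∀ X : S, Φ₀ X = κ (expMulC (X : VecField P 0 (EuclideanSpace ℂ (Fin 3))) (coeField U₀)))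
    (hH : ∀ τ : Fin (constrCardB 𝔅 k) → EuclideanSpace ℝ (Fin 3), ∃ p : VecField P 0 E3, cplxVec p ∈ S ∧
      ∀ i : Fin (constrCardB 𝔅 k), HasDerivAt (fun s : ℝ => ((avgFamily (fun j => blockAvg (P := P) (j := j) expMeanLogSU) (expMul su2Chart (s • p) U₀)
        ((constrEnumB 𝔅 k).symm i).1 ((constrEnumB 𝔅 k).symm i).2.1 : SU2) : Matrix (Fin 2) (Fin 2) ℂ))
        (((W ((constrEnumB 𝔅 k).symm i).1 ((constrEnumB 𝔅 k).symm i).2.1 : SU2) : Matrix (Fin 2) (Fin 2) ℂ) * ∑ b : Fin 3, ((τ i b : ℝ) : ℂ) • genE b) 0) :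
    Function.Surjective (fderiv ℂ Φ₀ 0) := by
  obtain ⟨cF, hcF, hcFinv⟩ := exists_conjCLM_pi (Fin (constrCardB 𝔅 k))
  obtain ⟨T, hT⟩ := exists_logCoordCLM
  -- `Φ₀ = Ψ ∘ val` with `Ψ X = κ (expMulC X ↑U₀)` analytic at `0`; its derivative on `S` is the restriction of `DΨ(0)`
  have hΨan : AnalyticAt ℂ (fun X : VecField P 0 (EuclideanSpace ℂ (Fin 3)) => κ (expMulC X (coeField U₀))) 0 := by
    have h1 : AnalyticAt ℂ κ (expMulC (0 : VecField P 0 (EuclideanSpace ℂ (Fin 3))) (coeField U₀)) := by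
      rw [expMulC_zero_left]; exact (eventually_analyticAt_datumCoord_of_guardOn 𝔅 k hk W κ hκ hg hU).self_of_nhds
    exact AnalyticAt.comp (f := fun X : VecField P 0 (EuclideanSpace ℂ (Fin 3)) => expMulC X (coeField U₀)) (x := 0) h1
      (analyticAt_expMulC_right (coeField U₀) 0)
  have hfun : Φ₀ = (fun X : VecField P 0 (EuclideanSpace ℂ (Fin 3)) => κ (expMulC X (coeField U₀))) ∘ (S.subtypeL : S →L[ℂ] VecField P 0 (EuclideanSpace ℂ (Fin 3))) :=
    funext fun X => hΦ₀ X
  have hD : fderiv ℂ Φ₀ 0 = (fderiv ℂ (fun X : VecField P 0 (EuclideanSpace ℂ (Fin 3)) => κ (expMulC X (coeField U₀))) 0).comp S.subtypeL := by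
    rw [hfun, fderiv_comp (0 : S) (by rw [map_zero]; exact hΨan.differentiableAt) S.subtypeL.differentiableAt, S.subtypeL.fderiv, map_zero]
  -- real targets are hit from the slice
  refine surjective_of_real_surjective cF hcFinv (fderiv ℂ Φ₀ 0) fun y hy => ?_
  -- the real coefficients of the real target `y`
  let τ : Fin (constrCardB 𝔅 k) → EuclideanSpace ℝ (Fin 3) := fun i => WithLp.toLp 2 fun b => (y i b).re
  have hyτ : ∀ i, (∑ b : Fin 3, ((τ i b : ℝ) : ℂ) • genE b) = ∑ b : Fin 3, y i b • genE b := by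
    intro i
    refine Finset.sum_congr rfl fun b _ => ?_
    have hb : ((τ i b : ℝ) : ℂ) = y i b := by
      have hfix := congrArg (fun v : Fin (constrCardB 𝔅 k) → EuclideanSpace ℂ (Fin 3) => v i b) hy
      simp only at hfix; rw [hcF] at hfix
      apply Complex.ext
      · simp [τ]
      · have h2 := congrArg Complex.im hfix
        rw [Complex.conj_im] at h2
        simp [τ]; linarith
    rw [hb]
  obtain ⟨p, hpS, hv⟩ := hH τ
  refine ⟨⟨cplxVec p, hpS⟩, ?_⟩
  funext i
  rw [hD, ContinuousLinearMap.coe_comp, Function.comp_apply, Submodule.subtypeL_apply,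
    fderiv_datumCoord_expMulC_apply_of_hasDerivAt_of_guardOn 𝔅 k hk W κ hκ hg hU hT p i (hv i), ← mul_assoc, star_coe_mul_coe_SU, one_mul, hyτ,
    logCoordCLM_genE_sum hT]

end Literature.MathematicalPhysics.QuantumFieldTheory.Balaban1983to89.B15Prop1OntoFromRightInverseTowerB

end
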